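import Summits.HodgeConjecture.HodgeConjecture.Theorems.VHCAbelianSchemesRoadSecantQuotientAnchorPinnedPrimeMarkman
import HarnessLib

/-!
# Road b02 (`VHCAbelianSchemesRoad`, D-0059) — the ONE NAMED ∀-NODE behind stub 2a‴ of the primed crux `SemiregularSheafRepresentativesTwPrimeAtDiag`
# (item stmt-HodgeConjecture-20707, skeleton v3.3): «SAME-LEVEL TRANSFER OF CARRIERS TO EVERY PINNED ANCHOR AND EVERY RATIONAL PINNED-SERVED WEIL
# DIRECTION» (`SecantQuotientWeilDirectionTransfer63 𝒪`), so that 2a‴ = L1″(AdmTw′) ∧ node (definitions and fact-free glue only)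

research route conditional on HC_CM; not a corollary; Q11.4-sentence-2 already refuted in dim ≥ 3.

DEFINITIONS AND FACT-FREE GLUE ONLY (`HC_CM` nowhere; no cell, carrier, residual, transfer, K-SR♭∃, VHC, `HC_AV` or HC asserted; the claim-tagged
preprint leaf L1″ `HodgeTheory.Markman2025_secantQuotient_twistedCarrier_onJacobian_pinned` enters the glue theorems as a HYPOTHESIS by name; the
print leaf `TwistedPerfectDoorPrime` of item 20706 is not restated). Director-hodge ruling R10.1 (S2) ∕ ring-2 LEAD 158 L158.1: type the research
excess of the `(6,3)` anchored-carrier stub `∀ C, SecantQuotientAnchorCarrier63PinnedPrime C` (p547560) over print as ONE named ∀-node, and land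
`secantQuotientAnchorCarrier63PinnedPrime_of_pinned_of_<Node>`. The companion theorem file `…AnchorPinnedPrimeMarkman` proved the junction with the
node DISPLAYED as a hypothesis; this file NAMES it and restates the junction by name.

WHAT PRINT GIVES (lane W1 `exists_carried_secantQuotientPinned_of_pinned`): modulo L1″(C, Adm), every even LEVEL `d ≥ 4` is SEEDED — ONE pinned
anchor `(Y_d, h_Y(θ₀))` of level `d` (print's generic curve and level structure) carries a `tw C Adm`-datum in ONE pinned-served rational direction
(the Weil component `γ₀` of `κ₃(𝓔̄ ⊗ det^{-1/8d})`, Thm. 1.4.1 item 4). WHAT THE STUB ASKS: a datum at EVERY pinned anchor (every smooth genus-3 curve,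
every admissible level structure, every chart, every polarisation class of `Θ` — gap (G1)) in EVERY rational pinned-served direction (the rational
points of the descended Weil plane off the `θ³`-ray, a `P¹(ℚ)`-worth per anchor — gap (G3)). THE NODE is exactly the passage from the former to the
latter INSIDE ONE LEVEL:

* `SecantQuotientWeilDirectionTransfer63 𝒪` (`@[conjecture]`, door-generic): for every level `d` and all pinned-served rational triples
  `(X, θ, w)`, `(X', θ', w')` whose anchors are level-`d` secant–quotient anchors with their class (`Markman2025.IsSecantQuotientAnchorWith d`),
  an `𝒪`-datum carrying `w'` at `(X', θ')` (`w' ∈ AbelianAll.carriedClasses 𝒪 6 3 X' θ'`) yields an `𝒪`-datum carrying `w` at `(X, θ)`.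
  At `X = X'`, `θ = θ'` this is «the OTHER rational Weil directions at each pinned anchor» (G3); across anchors of one level it is (G1).
* `SecantQuotientWeilDirectionTransfer63PinnedPrime C` (`@[conjecture]`): the node for the primed twisted door `tw C AdmTw′` — the reading the
  skeleton's stub 2a‴ consumes.
* GLUE BY NAME (all fact-free, from the companion file): **`secantQuotientAnchorCarrier63PinnedPrime_of_pinned_of_weilDirectionTransfer`:
  L1″(C, AdmTw′) ∧ `SecantQuotientWeilDirectionTransfer63PinnedPrime C` ⟹ `SecantQuotientAnchorCarrier63PinnedPrime C`**; the converse
  `weilDirectionTransfer63PinnedPrime_of_secantQuotientAnchorCarrier63PinnedPrime` (the stub implies the node outright); hence, modulo L1″(C, AdmTw′),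
  **2a‴ ⟺ node** (`secantQuotientAnchorCarrier63PinnedPrime_iff_weilDirectionTransfer63PinnedPrime_of_pinned`); the skeleton-shaped `∀ C` form; the
  aside twin 2a″ at `AdmTw` (item 19787); the same-anchor specialisation spelled out; and with the primed residual 2b‴ the primed `(6,3)` rung.

WHY THE NODE IS NOT IN PRINT AND MIGHT FAIL: Markman proves algebraicity of the other directions at CLASS level (Thm. 1.4.1 item 4: the `K`-action
`u ↦ u⁶` on `W_ℚ ≅ K` spans `K` over `ℚ`; Thm. 1.5.1: deformation along the Weil-type family), never a second semiregular object: deformation of a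
semiregular twisted sheaf inside the level-`d` family reaches finitely many directions per fibre (finite determinant monodromy of the Weil local
system), pull-back along the `K`-endomorphisms reaches the `u⁶`-multiples and is not known to preserve admissibility, and admissible data do not add
(direct sums are not semiregular — André column AE.1); at special (e.g. hyperelliptic) curves the secant sheaf may fail to be reflexive of rank `8d`
(Prop. 9.2.2) and a limit of admissible sheaves need not be admissible. The node is therefore OPEN research content, a HYPOTHESIS wherever used;
nothing here says it, L1″, 2a‴, 2a″, any cell, rung, crux, K-SR♭∃, VHC, `HC_AV`, `HC_CM` or HC holds.

References: [cite: Markman2025SecantWeil, §1.3 (p. 5), §1.5 (p. 7), Thm. 1.4.1 (item 4), Thm. 1.5.1, §9.2 Prop. 9.2.2 and §9.3 Lemma 9.3.11]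
[cite: Bloch1972Semiregularity, Remark (7.5)] [cite: BuchweitzFlenner2003, §5 Thm. 5.1] [cite: Pridham2024Semiregularity, Cor. 2.25 and Rem. 2.26]
[cite: vanGeemen1994HodgeAV, §2.4, Lemma 5.2, 5.4 and Thm. 4.11] [cite: MoonenZarhin1998WeilClasses, §1 (dim_K W_K = 1)].
-/

noncomputable section

open CategoryTheory CategoryTheory.Limits AlgebraicGeometry Topology

namespace Summit.HodgeConjecture.HodgeConjecture.Ring2.SemiregularRepresentatives

set_option linter.dupNamespace false -- the cell's namespace repeats the summit name, as in every `Ring2*` file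

open Literature.AlgebraicGeometry Literature.AlgebraicGeometry.Motives Literature.AlgebraicGeometry.Motives.AbelianVariety
open Literature.AlgebraicGeometry.HodgeTheory Literature.AlgebraicGeometry.Markman2025
open Literature.AlgebraicTopology.SingularHomology
open Summit.Ventures.HSemireg (ObjClass)
open Summit.HodgeConjecture.HodgeConjecture.Ring2.AbelianAll (carriedClasses)

/-! ## §1 The node -/

/-- **SAME-LEVEL TRANSFER OF `𝒪`-CARRIERS TO EVERY PINNED ANCHOR AND EVERY RATIONAL PINNED-SERVED WEIL DIRECTION at `(6,3)`
(`SecantQuotientWeilDirectionTransfer63 𝒪`)** — the ONE ∀-node behind the `(6,3)` anchored-carrier stub of the road: for every level `d`, all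
complex schemes `X`, `X'` with degree-2 classes `θ`, `θ'` exhibiting them as level-`d` secant–quotient anchors WITH THEIR CLASS (`X ≅ (J × Ĵ)/Ḡ`,
`θ = e^*h_Y(θ₀)`: `Markman2025.IsSecantQuotientAnchorWith d`), and all PINNED-SERVED RATIONAL classes `w ∈ 𝔖^pin X θ`, `w' ∈ 𝔖^pin X' θ'` (rational
points of the descended Weil planes off the `θ³`-rays): **if `w'` is carried by an `𝒪`-datum at `(X', θ')` modulo the `θ'`-ray (`w' ∈
AbelianAll.carriedClasses 𝒪 6 3 X' θ'`: degrees `I ∋ 3`, `𝒪`-admissible `κ` ON `X'`, `κ₃ = a·w' + c₃·θ'³`, `a ≠ 0`, `κ_q = c_q·θ'^q`), then `w` is carried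
by an `𝒪`-datum at `(X, θ)`**. At `X = X'`, `θ = θ'`: the OTHER rational Weil directions at a pinned anchor (gap (G3) of the road); across the anchors of
one level (other curves — e.g. hyperelliptic —, other level structures, other charts and pins): the genericity gap (G1). With the SEEDS print supplies at
every even level `d ≥ 4` (lane W1 `exists_carried_secantQuotientPinned_of_pinned`, modulo L1″) it GIVES the stub, and the stub gives it back (§2): 2a =
L1″ ∧ this. NOT IN PRINT (Markman reaches the other directions at CLASS level only — `K`-action `u ↦ u⁶` on `W_ℚ ≅ K`, Thm. 1.4.1 item 4, and deformation,
Thm. 1.5.1 —, never by a second admissible object; admissible data do not add); WHY IT MIGHT FAIL: finite determinant monodromy of the Weil local system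
(deformation reaches finitely many directions per fibre), admissibility under pull-back by `K`-endomorphisms unknown, degeneration of the secant sheaf at
special curves (Prop. 9.2.2), limits of admissible sheaves need not be admissible. OPEN; a HYPOTHESIS wherever used.
[cite: Markman2025SecantWeil, §1.5 (p. 7), Thm. 1.4.1 (item 4), Thm. 1.5.1 and §9.2 Prop. 9.2.2] [cite: Bloch1972Semiregularity, Remark (7.5)]
[cite: MoonenZarhin1998WeilClasses, §1] [cite: vanGeemen1994HodgeAV, Lemma 5.2 and 5.4] -/
@[conjecture] def SecantQuotientWeilDirectionTransfer63 (𝒪 : ObjClass) : Prop :=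
  ∀ (d : ℕ) ⦃X X' : SchemeOver ℂ⦄ ⦃θ : complexBetti X 2⦄ ⦃θ' : complexBetti X' 2⦄
    ⦃w : complexBetti X (2 * 3)⦄ ⦃w' : complexBetti X' (2 * 3)⦄,
    IsSecantQuotientAnchorWith d X θ → w ∈ secantQuotientServedClassesPinned X θ → IsRationalClass w →
    IsSecantQuotientAnchorWith d X' θ' → w' ∈ secantQuotientServedClassesPinned X' θ' → IsRationalClass w' →
    w' ∈ carriedClasses 𝒪 6 3 X' θ' → w ∈ carriedClasses 𝒪 6 3 X θ

/-- **The node for the PRIMED twisted door `tw C AdmTw′`**, `AdmTw′ := gluableSigmaAdmissible ∨ bfSingleAdmissible′`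
(`SecantQuotientWeilDirectionTransfer63PinnedPrime C`): same-level transfer of `AdmTw′`-admissible `B`-twisted data (σ-gluable bounded complexes of
vector bundles with `{1,…,6} ⊆ I`, or Buchweitz–Flenner data on an initial segment) to every pinned anchor and every rational pinned-served Weil
direction — the reading consumed by stub 2a‴ of skeleton v3.3 (item stmt-HodgeConjecture-20707): 2a‴ = L1″(C, AdmTw′) ∧ this (§2). OPEN; a HYPOTHESIS
wherever used. [cite: Markman2025SecantWeil, Thm. 1.4.1 (item 4), §1.5 and §9.3 Lemma 9.3.11] [cite: BuchweitzFlenner2003, §5 Thm. 5.1]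
[cite: Pridham2024Semiregularity, Cor. 2.25 and Rem. 2.26] [cite: Bloch1972Semiregularity, Remark (7.5)] -/
@[conjecture] def SecantQuotientWeilDirectionTransfer63PinnedPrime (C : ChernCharacterBetti) : Prop :=
  SecantQuotientWeilDirectionTransfer63 (Literature.AlgebraicGeometry.HodgeTheory.twistedReflexiveClass C
    (fun n X₀ I E => Summit.Ventures.HSemireg.gluableSigmaAdmissible n X₀ I E ∨
      Literature.AlgebraicGeometry.HodgeTheory.bfSingleAdmissible' n X₀ I E))

variable {𝒪 : ObjClass} {C : ChernCharacterBetti} {Adm : PerfectAdmissibility}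

/-- The primed node, unfolded (definitional). [cite: Markman2025SecantWeil, Thm. 1.4.1] -/
theorem secantQuotientWeilDirectionTransfer63PinnedPrime_iff :
    SecantQuotientWeilDirectionTransfer63PinnedPrime C ↔
      SecantQuotientWeilDirectionTransfer63 (Literature.AlgebraicGeometry.HodgeTheory.twistedReflexiveClass C
        (fun n X₀ I E => Summit.Ventures.HSemireg.gluableSigmaAdmissible n X₀ I E ∨
          Literature.AlgebraicGeometry.HodgeTheory.bfSingleAdmissible' n X₀ I E)) :=
  Iff.rfl

/-- **The same-anchor specialisation spelled out — «the OTHER rational Weil directions at a pinned anchor»**: under the node, at a level-`d` pinned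
anchor `(X, θ)` one carried rational pinned-served direction `w'` carries every rational pinned-served direction `w`.
[cite: Markman2025SecantWeil, Thm. 1.4.1 (item 4)] [cite: MoonenZarhin1998WeilClasses, §1] -/
theorem SecantQuotientWeilDirectionTransfer63.sameAnchor (hN : SecantQuotientWeilDirectionTransfer63 𝒪) {d : ℕ} {X : SchemeOver ℂ}
    {θ : complexBetti X 2} (hX : IsSecantQuotientAnchorWith d X θ) {w w' : complexBetti X (2 * 3)}
    (hw : w ∈ secantQuotientServedClassesPinned X θ) (hwQ : IsRationalClass w) (hw' : w' ∈ secantQuotientServedClassesPinned X θ)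
    (hw'Q : IsRationalClass w') (hc : w' ∈ carriedClasses 𝒪 6 3 X θ) : w ∈ carriedClasses 𝒪 6 3 X θ :=
  hN d hX hw hwQ hX hw' hw'Q hc

/-! ## §2 Glue by name: 2a = L1″ ∧ node -/

/-- **The 2a-body at the pinned data IMPLIES the node** (door-generic; the node's conclusion holds outright).
[cite: Bloch1972Semiregularity, Remark (7.5)] [cite: Markman2025SecantWeil, Thm. 1.4.1] -/
theorem weilDirectionTransfer63_of_anchoredCarrierAt_secantQuotientPinned
    (h : AnchoredCarrierAt 𝒪 6 3 (fun X θ ↦ secantQuotientAnchorsPinned X θ) (fun X θ ↦ secantQuotientServedClassesPinned X θ)) :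
    SecantQuotientWeilDirectionTransfer63 𝒪 :=
  transfer_of_anchoredCarrierAt_secantQuotientPinned h

/-- **L1″(C, Adm) ∧ node(tw C Adm) ⟹ the 2a-body at `tw C Adm`** (any `Adm`; seeds from print, transfer from the node).
[cite: Markman2025SecantWeil, Thm. 1.4.1 (item 4), §1.5 and Thm. 1.5.1] [cite: Bloch1972Semiregularity, Remark (7.5)] -/
theorem anchoredCarrierAt_secantQuotientPinned_of_pinned_of_weilDirectionTransfer63
    (hM : Markman2025_secantQuotient_twistedCarrier_onJacobian_pinned C Adm)
    (hN : SecantQuotientWeilDirectionTransfer63 (twistedReflexiveClass C Adm)) :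
    AnchoredCarrierAt (twistedReflexiveClass C Adm) 6 3 (fun X θ ↦ secantQuotientAnchorsPinned X θ)
      (fun X θ ↦ secantQuotientServedClassesPinned X θ) :=
  anchoredCarrierAt_secantQuotientPinned_of_pinned_of_transfer hM hN

/-- **STUB 2a‴ FROM PRINT AND THE NODE: `L1″(C, AdmTw′) ∧ SecantQuotientWeilDirectionTransfer63PinnedPrime C ⟹
SecantQuotientAnchorCarrier63PinnedPrime C`** — the `(6,3)` anchored-carrier stub of skeleton v3.3 (item stmt-HodgeConjecture-20707) is print's pinned
claim READ AT THE PRIMED DOOR (arXiv:2502.03415, PREPRINT, by name) plus the one named node. Nothing here says either input holds.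
[cite: Markman2025SecantWeil, Thm. 1.4.1 (item 4), §1.5, Thm. 1.5.1 and Lemma 9.3.11] [cite: Bloch1972Semiregularity, Remark (7.5)] [cite: BuchweitzFlenner2003, §5 Thm. 5.1] -/
theorem secantQuotientAnchorCarrier63PinnedPrime_of_pinned_of_weilDirectionTransfer
    (hM : Markman2025_secantQuotient_twistedCarrier_onJacobian_pinned C
      (fun n X₀ I E => Summit.Ventures.HSemireg.gluableSigmaAdmissible n X₀ I E ∨
        Literature.AlgebraicGeometry.HodgeTheory.bfSingleAdmissible' n X₀ I E))
    (hN : SecantQuotientWeilDirectionTransfer63PinnedPrime C) : SecantQuotientAnchorCarrier63PinnedPrime C :=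
  secantQuotientAnchorCarrier63PinnedPrime_of_pinned_of_transfer hM hN

/-- **Stub 2a‴ ⟹ the primed node** (outright). [cite: Bloch1972Semiregularity, Remark (7.5)] [cite: Markman2025SecantWeil, Thm. 1.4.1] -/
theorem weilDirectionTransfer63PinnedPrime_of_secantQuotientAnchorCarrier63PinnedPrime (h : SecantQuotientAnchorCarrier63PinnedPrime C) :
    SecantQuotientWeilDirectionTransfer63PinnedPrime C :=
  transfer_of_secantQuotientAnchorCarrier63PinnedPrime h

/-- **Modulo L1″(C, AdmTw′): 2a‴ ⟺ the primed node** — the stub is print plus exactly this node; provers stare at the node.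
[cite: Markman2025SecantWeil, Thm. 1.4.1 (item 4), §1.5 and Thm. 1.5.1] [cite: Bloch1972Semiregularity, Remark (7.5)] -/
theorem secantQuotientAnchorCarrier63PinnedPrime_iff_weilDirectionTransfer63PinnedPrime_of_pinned
    (hM : Markman2025_secantQuotient_twistedCarrier_onJacobian_pinned C
      (fun n X₀ I E => Summit.Ventures.HSemireg.gluableSigmaAdmissible n X₀ I E ∨
        Literature.AlgebraicGeometry.HodgeTheory.bfSingleAdmissible' n X₀ I E)) :
    SecantQuotientAnchorCarrier63PinnedPrime C ↔ SecantQuotientWeilDirectionTransfer63PinnedPrime C :=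
  ⟨weilDirectionTransfer63PinnedPrime_of_secantQuotientAnchorCarrier63PinnedPrime,
    secantQuotientAnchorCarrier63PinnedPrime_of_pinned_of_weilDirectionTransfer hM⟩

/-- **Skeleton-shaped `∀ C` form**: `(∀ C, L1″ C AdmTw′) ∧ (∀ C, SecantQuotientWeilDirectionTransfer63PinnedPrime C) ⟹
∀ C, SecantQuotientAnchorCarrier63PinnedPrime C` — the exact type of `stub_anchorCarrier_63_secantQuotientPinnedPrime` (skeleton v3.3).
[cite: Markman2025SecantWeil, Thm. 1.4.1 (item 4), §1.5 and Lemma 9.3.11] [cite: Bloch1972Semiregularity, Remark (7.5)] -/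
theorem forall_secantQuotientAnchorCarrier63PinnedPrime_of_pinned_of_weilDirectionTransfer
    (hM : ∀ C : ChernCharacterBetti, Markman2025_secantQuotient_twistedCarrier_onJacobian_pinned C
      (fun n X₀ I E => Summit.Ventures.HSemireg.gluableSigmaAdmissible n X₀ I E ∨
        Literature.AlgebraicGeometry.HodgeTheory.bfSingleAdmissible' n X₀ I E))
    (hN : ∀ C : ChernCharacterBetti, SecantQuotientWeilDirectionTransfer63PinnedPrime C) :
    ∀ C : ChernCharacterBetti, SecantQuotientAnchorCarrier63PinnedPrime C :=
  fun C ↦ secantQuotientAnchorCarrier63PinnedPrime_of_pinned_of_weilDirectionTransfer (hM C) (hN C)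

/-- **The aside twin at the door of record** (stub 2a″ of skeleton v3.1, item stmt-HodgeConjecture-19787): `L1″(C, AdmTw) ∧ node(tw C AdmTw) ⟹
SecantQuotientAnchorCarrier63Pinned C`. [cite: Markman2025SecantWeil, Thm. 1.4.1 (item 4), §1.5 and Thm. 1.5.1] [cite: Bloch1972Semiregularity, Remark (7.5)] -/
theorem secantQuotientAnchorCarrier63Pinned_of_pinned_of_weilDirectionTransfer
    (hM : Markman2025_secantQuotient_twistedCarrier_onJacobian_pinned C
      (fun n X₀ I E => Summit.Ventures.HSemireg.gluableSigmaAdmissible n X₀ I E ∨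
        Literature.AlgebraicGeometry.HodgeTheory.bfSingleAdmissible n X₀ I E))
    (hN : SecantQuotientWeilDirectionTransfer63 (twistedReflexiveClass C
      (fun n X₀ I E => Summit.Ventures.HSemireg.gluableSigmaAdmissible n X₀ I E ∨
        Literature.AlgebraicGeometry.HodgeTheory.bfSingleAdmissible n X₀ I E))) :
    SecantQuotientAnchorCarrier63Pinned C :=
  secantQuotientAnchorCarrier63Pinned_of_pinned_of_transfer hM hN

/-- **The primed inputs also serve the aside 2a″** (`SecantQuotientAnchorCarrier63Pinned_of_prime`: a primed carrier is a carrier of record).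
[cite: Markman2025SecantWeil, Thm. 1.4.1] [cite: BuchweitzFlenner2003, §5 Thm. 5.1] -/
theorem secantQuotientAnchorCarrier63Pinned_of_pinnedPrime_of_weilDirectionTransfer63PinnedPrime
    (hM : Markman2025_secantQuotient_twistedCarrier_onJacobian_pinned C
      (fun n X₀ I E => Summit.Ventures.HSemireg.gluableSigmaAdmissible n X₀ I E ∨
        Literature.AlgebraicGeometry.HodgeTheory.bfSingleAdmissible' n X₀ I E))
    (hN : SecantQuotientWeilDirectionTransfer63PinnedPrime C) : SecantQuotientAnchorCarrier63Pinned C :=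
  secantQuotientAnchorCarrier63Pinned_of_prime (secantQuotientAnchorCarrier63PinnedPrime_of_pinned_of_weilDirectionTransfer hM hN)

/-- **With the primed residual 2b‴: L1″(C, AdmTw′) ∧ node ∧ `SecantQuotientResidual63PinnedPrime C` ⟹ the PRIMED `(6,3)` RUNG**
`LefAtExceptionalRegimeSixfoldMiddle (tw C AdmTw′)` (skeleton v3.3's `rung_sixfoldMiddleTwPrime` at `C`, via p547560's glue). Nothing here says any input holds.
[cite: Markman2025SecantWeil, Thm. 1.4.1 and Thm. 1.5.1] [cite: vanGeemen1994HodgeAV, Thm. 4.11] [cite: Bloch1972Semiregularity, Remark (7.5)] -/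
theorem lefAtExceptionalRegimeSixfoldMiddle_twPrime_of_pinned_of_weilDirectionTransfer_of_residual
    (hM : Markman2025_secantQuotient_twistedCarrier_onJacobian_pinned C
      (fun n X₀ I E => Summit.Ventures.HSemireg.gluableSigmaAdmissible n X₀ I E ∨
        Literature.AlgebraicGeometry.HodgeTheory.bfSingleAdmissible' n X₀ I E))
    (hN : SecantQuotientWeilDirectionTransfer63PinnedPrime C) (hR : SecantQuotientResidual63PinnedPrime C) :
    LefAtExceptionalRegimeSixfoldMiddle (Literature.AlgebraicGeometry.HodgeTheory.twistedReflexiveClass C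
      (fun n X₀ I E => Summit.Ventures.HSemireg.gluableSigmaAdmissible n X₀ I E ∨
        Literature.AlgebraicGeometry.HodgeTheory.bfSingleAdmissible' n X₀ I E)) :=
  lefAtExceptionalRegimeSixfoldMiddle_twPrime_of_pinnedPrime
    (secantQuotientAnchorCarrier63PinnedPrime_of_pinned_of_weilDirectionTransfer hM hN) hR

end Summit.HodgeConjecture.HodgeConjecture.Ring2.SemiregularRepresentatives

end
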